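import Summits.BirchSwinnertonDyer.Rank1Residual.Additive.X4RankZeroVisibleLowerBound
import Literature.NumberTheory.EllipticCurves.CongruentNumberCurveSupersingular
import Literature.NumberTheory.EllipticCurves.SelmerCorankControlRatProofs
import HarnessLib

/-!
# The T-VIS3 ENDs of `X4RankZeroVisibleLowerBound` with `S` = the places over a PRIME LIST — record-side
# adapters (team n1011, ROW T-VIS3-REC (T); written by seat p18 GEN 8, filed by p18 GEN 9 on the lead's ruling
# R5-82 (d) "(T) GO TONIGHT"; n1011-p03 GEN 10: "FINE, YOURS"; TOOL theorems, close nothing)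

HONEST FRAMING (cell `b2b-bsdres`, run/shared/lean/b2b/bsd-rank1-residual/, verbatim in every
file): the goal of the cell is to DELETE the COMBINATION-SHAPED residual classes of the
Birch–Swinnerton-Dyer formula for ALL analytic-rank `≤ 1` elliptic curves over `ℚ` — "full BSD
formula for every rank `≤ 1` curve in class `C`" assembled STRICTLY from published theorems — so
that the rank-`≤ 1` remainder becomes exactly the CONSTRUCTION-SHAPED classes, which are TYPED
(missing-input `Prop`s), NOT attempted. This is not "finishing BSD". Team n1011 (N11 = X4 ∧ `p = 3`),
research route; TOOL theorems; close nothing; nothing booked; no definition, no named fact, no `sorry`.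

n1011-p03's two visibility ENDs (p304185) — `X4RankZero.bsdp_three_potMult_of_congr_of_rank_two`
((M) rows, `p = 3`) and `X4RankZero.bsdp_of_congr_of_rank_two_of_kato` (potentially good rows, odd `p`)
— with the finite set of places `S` replaced by "the places over a list of rational primes `L ∋ p`"
on which both integral discriminants are supported (x11c's pattern `X11b/VisibilityPrimeList.lean`;
outside those places both curves have good reduction, Silverman VII.5.1(a), and the place does not
divide `p`), so that a record asks the local binder per PRIME: `∀ v, primesEquiv v ∈ L → #E′(ℚ_v)[p] = 1`
— the shape the kernel dischargers `GaloisImage/LocalThreeTorsionAdicCompletion.lean` /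
`GaloisImage/LocalTorsionAwayFromPAdicCompletion.lean` feed place by place.

References: [SilvermanAEC2009] VII.5 Prop. 5.1(a); [CremonaMazur2000] §3; [Kato2004Asterisque] Thm. 14.5;
[Delbourgo1998] Prop. 4.
-/

set_option autoImplicit false

noncomputable section

open scoped Classical NumberField
open IsDedekindDomain NumberField WeierstrassCurve Rat.HeightOneSpectrum
  Literature.NumberTheory.EllipticCurves Literature.NumberTheory.EllipticCurves.ModularForms
  Literature.NumberTheory.EllipticCurves.Rank1Residual
  Literature.NumberTheory.EllipticCurves.Rank1Residual.Typed
  Literature.NumberTheory.GaloisRepresentations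

namespace Summit.BirchSwinnertonDyer.Rank1Residual.Additive

/-! ### §1. The (M)-END over the places of a prime list -/

/-- **p03's (M)-END `X4RankZero.bsdp_three_potMult_of_congr_of_rank_two` with `S` = the places over
a list of rational primes `L ∋ 3`** supporting both discriminants (`E₀`, `F₀` integer models of `W`,
`W′`): outside those places both curves have good reduction (Silverman VII.5.1(a)) and the place does
not divide `3`, so `hloc` is asked only at the primes of `L`. [cite: SilvermanAEC2009, VII.5 Prop. 5.1(a)]
[cite: CremonaMazur2000, §3 and Table 1] -/
theorem X4RankZero.bsdp_three_potMult_of_congr_of_rank_two_of_primeList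
    (hKatoS : Kato2004.rankZero_padicValNat_sha_le_sub_localTamagawa_of_additive_potGood_of_imageContainsSL2)
    (hDel : Delbourgo1998.prop4_rankZero_pow_dvd_constantCoeff)
    (hGZK : rank_eq_analyticRank_of_analyticRank_le_one) (hmod : hasEntireLFunction_rat)
    (hmodD : nonempty_modularParametrizationData)
    (hKatoχ : Wuthrich2014.kato_halfEigenCharIdeal_dvd_cyclotomicPrime_of_surjective)
    (hCT : exists_casselsTate_pairing (K := ℚ))
    (W : WeierstrassCurve ℚ) [W.IsElliptic] [W.IsGloballyMinimal] (hr : W.analyticRank = 0)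
    (hX : haveI : Fact (Nat.Prime 3) := ⟨Nat.prime_three⟩; ClassX4 W 3)
    (hsurj : W.HasSurjectiveModNGaloisRep 3) (hj : padicValRat 3 W.j < 0)
    {q : ℚ} (hq : shaAn W = (q : ℂ)) (hv : padicValRat 3 q ≤ 2)
    (W' : WeierstrassCurve ℚ) [W'.IsElliptic]
    (θ : geomTorsion W' ((3 : ℕ) : ℤ) ≃+ geomTorsion W ((3 : ℕ) : ℤ))
    (hθ : ∀ (σ : Field.absoluteGaloisGroup ℚ) (P : geomTorsion W' ((3 : ℕ) : ℤ)),
      θ (σ • P) = σ • θ P)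
    (hrank : 2 ≤ W'.mordellWeilRank)
    {E₀ F₀ : WeierstrassCurve ℤ} (hE : E₀.map (Int.castRingHom ℚ) = W)
    (hF : F₀.map (Int.castRingHom ℚ) = W') (L : List ℕ) (h3L : 3 ∈ L)
    (hΔE : ∀ q : ℕ, q.Prime → (q : ℤ) ∣ E₀.Δ → q ∈ L)
    (hΔF : ∀ q : ℕ, q.Prime → (q : ℤ) ∣ F₀.Δ → q ∈ L)
    (hloc : ∀ v : HeightOneSpectrum (𝓞 ℚ), (primesEquiv v : ℕ) ∈ L →
      Nat.card (nsmulAddMonoidHom 3 :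
        (W'.baseChange (v.adicCompletion ℚ)).toAffine.Point →+ _).ker = 1) :
    haveI : Fact (Nat.Prime 3) := ⟨Nat.prime_three⟩
    BSDp W 3 := by
  set e := primesEquiv (R := 𝓞 ℚ) with he
  -- the finite set of places over `L`
  set S : Finset (HeightOneSpectrum (𝓞 ℚ)) :=
    (L.filterMap fun q ↦ if h : q.Prime then some (e.symm ⟨q, h⟩) else none).toFinset with hSdef
  have hmemS : ∀ v : HeightOneSpectrum (𝓞 ℚ), v ∈ S ↔ (e v : ℕ) ∈ L := by
    intro v
    rw [hSdef, List.mem_toFinset, List.mem_filterMap]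
    constructor
    · rintro ⟨q, hq, hqv⟩
      by_cases hqp : q.Prime
      · rw [dif_pos hqp, Option.some.injEq] at hqv
        rw [← hqv, Equiv.apply_symm_apply]
        exact hq
      · rw [dif_neg hqp] at hqv
        exact absurd hqv (by simp)
    · intro hv
      refine ⟨(e v : ℕ), hv, ?_⟩
      rw [dif_pos (e v).2]
      simp
  refine X4RankZero.bsdp_three_potMult_of_congr_of_rank_two hKatoS hDel hGZK hmod hmodD hKatoχ hCT W hr
    hX hsurj hj hq hv W' θ hθ hrank S (fun v hvS ↦ ?_) (fun v hvS ↦ hloc v ((hmemS v).mp hvS))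
  have hvL : (e v : ℕ) ∉ L := fun h ↦ hvS ((hmemS v).mpr h)
  have hqp : (e v : ℕ).Prime := (e v).2
  refine ⟨?_, ?_, fun h3v ↦ hvL ?_⟩
  · rw [← hE]
    exact hasGoodReductionAt_map_of_not_dvd E₀ v fun h ↦ hvL (hΔE _ hqp h)
  · rw [← hF]
    exact hasGoodReductionAt_map_of_not_dvd F₀ v fun h ↦ hvL (hΔF _ hqp h)
  · rw [he, Rat.HeightOneSpectrum.primesEquiv_eq_of_natCast_mem v Nat.prime_three h3v]
    exact h3L

/-! ### §2. The potentially-good END over the places of a prime list -/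

/-- **p03's (G)-END `X4RankZero.bsdp_of_congr_of_rank_two_of_kato` with `S` = the places over a list
of rational primes `L ∋ p`** supporting both discriminants (`E₀`, `F₀` integer models of `W`, `W′`):
outside those places both curves have good reduction (Silverman VII.5.1(a)) and the place does not
divide `p`. [cite: SilvermanAEC2009, VII.5 Prop. 5.1(a)] [cite: Kato2004Asterisque, Thm. 14.5 (3) (p. 236)] -/
theorem X4RankZero.bsdp_of_congr_of_rank_two_of_kato_of_primeList
    (hKato : Kato2004.rankZero_padicValNat_sha_le_of_additive_potGood_of_imageContainsSL2)
    (hCT : exists_casselsTate_pairing (K := ℚ))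
    (hGZK : rank_eq_analyticRank_of_analyticRank_le_one) (hmod : hasEntireLFunction_rat)
    (W : WeierstrassCurve ℚ) [W.IsElliptic] [W.IsGloballyMinimal] (p : ℕ) [Fact p.Prime] (hp : p ≠ 2)
    (hr : W.analyticRank = 0) (hX : ClassX4 W p) (hpot : 0 ≤ padicValRat p W.j)
    (hsurj : ∀ n : ℕ, W.HasSurjectiveModNGaloisRep (p ^ n : ℕ)) (htam : ¬ p ∣ W.tamagawaProduct)
    {N : ℕ} [NeZero N] (D : ModularParametrizationData W N) (hc : ¬ (p : ℤ) ∣ D.maninConstant)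
    {q : ℚ} (hq : shaAn W = (q : ℂ)) (hv : padicValRat p q ≤ 2)
    (W' : WeierstrassCurve ℚ) [W'.IsElliptic]
    (θ : geomTorsion W' (p : ℤ) ≃+ geomTorsion W (p : ℤ))
    (hθ : ∀ (σ : Field.absoluteGaloisGroup ℚ) (P : geomTorsion W' (p : ℤ)), θ (σ • P) = σ • θ P)
    (hrank : 2 ≤ W'.mordellWeilRank)
    {E₀ F₀ : WeierstrassCurve ℤ} (hE : E₀.map (Int.castRingHom ℚ) = W)
    (hF : F₀.map (Int.castRingHom ℚ) = W') (L : List ℕ) (hpL : p ∈ L)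
    (hΔE : ∀ q : ℕ, q.Prime → (q : ℤ) ∣ E₀.Δ → q ∈ L)
    (hΔF : ∀ q : ℕ, q.Prime → (q : ℤ) ∣ F₀.Δ → q ∈ L)
    (hloc : ∀ v : HeightOneSpectrum (𝓞 ℚ), (primesEquiv v : ℕ) ∈ L →
      Nat.card (nsmulAddMonoidHom p :
        (W'.baseChange (v.adicCompletion ℚ)).toAffine.Point →+ _).ker = 1) :
    BSDp W p := by
  have hpp : p.Prime := Fact.out
  set e := primesEquiv (R := 𝓞 ℚ) with he
  set S : Finset (HeightOneSpectrum (𝓞 ℚ)) :=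
    (L.filterMap fun q ↦ if h : q.Prime then some (e.symm ⟨q, h⟩) else none).toFinset with hSdef
  have hmemS : ∀ v : HeightOneSpectrum (𝓞 ℚ), v ∈ S ↔ (e v : ℕ) ∈ L := by
    intro v
    rw [hSdef, List.mem_toFinset, List.mem_filterMap]
    constructor
    · rintro ⟨q, hq, hqv⟩
      by_cases hqp : q.Prime
      · rw [dif_pos hqp, Option.some.injEq] at hqv
        rw [← hqv, Equiv.apply_symm_apply]
        exact hq
      · rw [dif_neg hqp] at hqv
        exact absurd hqv (by simp)
    · intro hv
      refine ⟨(e v : ℕ), hv, ?_⟩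
      rw [dif_pos (e v).2]
      simp
  refine X4RankZero.bsdp_of_congr_of_rank_two_of_kato hKato hCT hGZK hmod W p hp hr hX hpot hsurj htam D
    hc hq hv W' θ hθ hrank S (fun v hvS ↦ ?_) (fun v hvS ↦ hloc v ((hmemS v).mp hvS))
  have hvL : (e v : ℕ) ∉ L := fun h ↦ hvS ((hmemS v).mpr h)
  have hqp : (e v : ℕ).Prime := (e v).2
  refine ⟨?_, ?_, fun hpv ↦ hvL ?_⟩
  · rw [← hE]
    exact hasGoodReductionAt_map_of_not_dvd E₀ v fun h ↦ hvL (hΔE _ hqp h)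
  · rw [← hF]
    exact hasGoodReductionAt_map_of_not_dvd F₀ v fun h ↦ hvL (hΔF _ hqp h)
  · rw [he, Rat.HeightOneSpectrum.primesEquiv_eq_of_natCast_mem v hpp hpv]
    exact hpL

end Summit.BirchSwinnertonDyer.Rank1Residual.Additive

end
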